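import Summits.ValiantsHypothesis.ValiantsHypothesis.Theorems.LacunarySymmetroidMatrixDescartesCensusPivotTwoDefinitePivot

/-!
# `MatrixDescartes` census — pivot column at `m = 2`: CONGRUENCE INVARIANCE and the NORMAL FORM `J = diag(−1, 1)`
# of the indefinite pivot (the open case of the `2K` law reduces to ONE pivot letter)

HONEST FRAMING.  Object-search cell `pub-symmetroid`, Conjecture-B column in PIVOT currency (`…CensusPivotDefs.lean`, seat conjb-1),
seat `val-sym-mdr-p1` (generation 7).  Helper file landed `--supports` the crux item stmt-ValiantsHypothesis-18050
(`Theses.LacunarySymmetroid.MatrixDescartes`, OPEN, on HOLD) with NO closure claim.  Bookkeeping for the `(2, K)` pivot rows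
(`Z₊ ≤ 2K` conjectured by the lineage; tree: `≤ 2K + 2` always, `= 2K` for `K ≤ 3`, `∈ {8, 9, 10}` at `K = 4`; by
`…PivotTwoDefinitePivot` only the INDEFINITE pivot `det J < 0` is open):

* **`pivotPosRoots_congr`** (every size `m`, every `K`): `Z₊` is invariant under a congruence `J ↦ Cᵀ J C`, `Pₖ ↦ Cᵀ Pₖ C`
  with `det C ≠ 0` (the pencil polynomial is multiplied by the non-zero constant `(det C)²`).
* **`exists_congr_eq_normalForm`**: a real symmetric `2 × 2` matrix `J` with `det J < 0` is congruent to `!![-1, 0; 0, 1]`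
  (an explicit `J`-orthogonal frame: a vector `v` with `vᵀ J v < 0` and `w = (−(J v)₁, (J v)₀)`; no spectral theorem).
* **REDUCTION TO ONE PIVOT LETTER** (`pivotPosRoots_le_of_normalForm`, `pivotRootLawAt_two_of_normalForm`): a bound `Z₊ ≤ B`
  proved for the single pivot letter `J₀ = !![-1, 0; 0, 1]` (all exponents, all PSD letters) holds for every indefinite pivot,
  and for `B = 2K` gives the row `PivotRootLawAt 2 K q (2K)` at every index `q`.

So the open content of the `m = 2` pivot law is: for `F(X) = X^e • diag(−1,1) + ∑ₖ X^{dₖ} • Pₖ` (`Pₖ ⪰ 0`), `Z₊ ≤ 2K`.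
The companion `…CensusPivotTwoEnvelope` turns this into a statement about ONE real function of one variable.
Nothing here bears on `Theses.LacunarySymmetroid.MatrixDescartes` in its window, on `KPlusLogSqLaw`, on `DoorA26` / `DoorA34`,
on the cell's registers or credences, or on `VP ≠ VNP`.

[folklore] Elementary linear algebra (congruence of a binary quadratic form of negative discriminant to `−x² + y²`).
No definitions, no named facts.
-/

-- `Summit.ValiantsHypothesis.ValiantsHypothesis.…` repeats a component by the D-0017 layout
-- (single-conjunct summit), which the `dupNamespace` linter flags; the name is mandated.
set_option linter.dupNamespace false

namespace Summit.ValiantsHypothesis.ValiantsHypothesis.Theorems.LacunarySymmetroidMatrixDescartes.Pivot.TwoNormalForm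

open Matrix Finset Polynomial
open scoped BigOperators

/-! ## Congruence invariance of `Z₊` (every size) -/

section congr

variable {m K : ℕ}

/-- Congruence commutes with forming the pencil: `C̃ᵀ (X^e • J + ∑ X^{dₖ} • Pₖ) C̃ = X^e • (Cᵀ J C) + ∑ X^{dₖ} • (Cᵀ Pₖ C)`
where `C̃ = C.map Polynomial.C`. [folklore] -/
theorem congr_pencil (e : ℕ) (d : Fin K → ℕ) (J : Matrix (Fin m) (Fin m) ℝ) (P : Fin K → Matrix (Fin m) (Fin m) ℝ)
    (C : Matrix (Fin m) (Fin m) ℝ) :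
    (C.map Polynomial.C)ᵀ * (((X : ℝ[X]) ^ e) • J.map Polynomial.C + ∑ k, ((X : ℝ[X]) ^ d k) • (P k).map Polynomial.C)
        * C.map Polynomial.C
      = ((X : ℝ[X]) ^ e) • (Cᵀ * J * C).map Polynomial.C
          + ∑ k, ((X : ℝ[X]) ^ d k) • (Cᵀ * P k * C).map Polynomial.C := by
  rw [Matrix.mul_add, Matrix.add_mul, Matrix.mul_smul, Matrix.smul_mul, Finset.mul_sum, Finset.sum_mul]
  congr 1
  · rw [Matrix.map_mul, Matrix.map_mul, Matrix.transpose_map]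
  · refine Finset.sum_congr rfl fun k _ => ?_
    rw [Matrix.mul_smul, Matrix.smul_mul, Matrix.map_mul, Matrix.map_mul, Matrix.transpose_map]

/-- The determinant of the congruent pencil is `(det C)²` (as a constant) times the determinant of the pencil. [folklore] -/
theorem det_congr_pencil (e : ℕ) (d : Fin K → ℕ) (J : Matrix (Fin m) (Fin m) ℝ) (P : Fin K → Matrix (Fin m) (Fin m) ℝ)
    (C : Matrix (Fin m) (Fin m) ℝ) :
    Matrix.det (((X : ℝ[X]) ^ e) • (Cᵀ * J * C).map Polynomial.C
          + ∑ k, ((X : ℝ[X]) ^ d k) • (Cᵀ * P k * C).map Polynomial.C)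
      = Polynomial.C (C.det ^ 2)
          * Matrix.det (((X : ℝ[X]) ^ e) • J.map Polynomial.C + ∑ k, ((X : ℝ[X]) ^ d k) • (P k).map Polynomial.C) := by
  rw [← congr_pencil, Matrix.det_mul, Matrix.det_mul, Matrix.det_transpose]
  have hC : (C.map Polynomial.C).det = Polynomial.C C.det := by
    rw [show C.map (Polynomial.C : ℝ → ℝ[X]) = (Polynomial.C : ℝ →+* ℝ[X]).mapMatrix C from rfl, ← RingHom.map_det]
  rw [hC, map_pow]
  ring

/-- **Congruence invariance of `Z₊`**: for `det C ≠ 0`, the pencil with letters `Cᵀ J C`, `Cᵀ Pₖ C` has the same number of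
distinct positive determinant roots as the pencil with letters `J`, `Pₖ`. [folklore] -/
theorem pivotPosRoots_congr (e : ℕ) (d : Fin K → ℕ) (J : Matrix (Fin m) (Fin m) ℝ) (P : Fin K → Matrix (Fin m) (Fin m) ℝ)
    (C : Matrix (Fin m) (Fin m) ℝ) (hC : C.det ≠ 0) :
    pivotPosRoots e d (Cᵀ * J * C) (fun k => Cᵀ * P k * C) = pivotPosRoots e d J P := by
  unfold pivotPosRoots
  rw [det_congr_pencil, Polynomial.roots_C_mul _ (pow_ne_zero 2 hC)]

/-- Congruence preserves symmetry. [folklore] -/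
theorem isSymm_congr {J : Matrix (Fin m) (Fin m) ℝ} (hJ : J.IsSymm) (C : Matrix (Fin m) (Fin m) ℝ) :
    (Cᵀ * J * C).IsSymm := by
  unfold Matrix.IsSymm at hJ ⊢
  rw [Matrix.transpose_mul, Matrix.transpose_mul, Matrix.transpose_transpose, hJ, Matrix.mul_assoc]

/-- Congruence preserves positive semidefiniteness. [folklore] -/
theorem posSemidef_congr {P : Matrix (Fin m) (Fin m) ℝ} (hP : P.PosSemidef) (C : Matrix (Fin m) (Fin m) ℝ) :
    (Cᵀ * P * C).PosSemidef := by
  have h := hP.conjTranspose_mul_mul_same C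
  rwa [Matrix.conjTranspose_eq_transpose_of_trivial] at h

end congr

/-! ## The normal form of an indefinite `2 × 2` pivot letter -/

section normalForm

/-- Entries of a `2 × 2` congruence `Cᵀ J C`. [folklore] -/
theorem congr_apply_two (C J : Matrix (Fin 2) (Fin 2) ℝ) (i j : Fin 2) :
    (Cᵀ * J * C) i j
      = C 0 i * J 0 0 * C 0 j + C 0 i * J 0 1 * C 1 j + C 1 i * J 1 0 * C 0 j + C 1 i * J 1 1 * C 1 j := by
  simp only [Matrix.mul_apply, Fin.sum_univ_two, Matrix.transpose_apply]
  ring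

/-- An indefinite binary quadratic form takes a negative value: if `J` is a real symmetric `2 × 2` matrix with `det J < 0`
there are `v₀, v₁` with `J₀₀ v₀² + 2 J₀₁ v₀ v₁ + J₁₁ v₁² < 0` (explicit: a coordinate vector, `(J₀₁, −J₀₀)` or
`(J₁₁ + 1, −J₀₁)`). [folklore] -/
theorem exists_quadForm_neg (J : Matrix (Fin 2) (Fin 2) ℝ) (hJ : J.IsSymm) (hdet : J.det < 0) :
    ∃ v₀ v₁ : ℝ, J 0 0 * v₀ * v₀ + 2 * J 0 1 * v₀ * v₁ + J 1 1 * v₁ * v₁ < 0 := by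
  have h10 : J 1 0 = J 0 1 := hJ.apply 0 1
  have hd : J 0 0 * J 1 1 - J 0 1 * J 0 1 < 0 := by
    rw [Matrix.det_fin_two, h10] at hdet; exact hdet
  rcases lt_or_ge (J 0 0) 0 with ha | ha
  · exact ⟨1, 0, by nlinarith⟩
  rcases lt_or_ge (J 1 1) 0 with hc | hc
  · exact ⟨0, 1, by nlinarith⟩
  rcases ha.eq_or_lt with ha0 | ha0
  · -- `J₀₀ = 0`: then `J₀₁ ≠ 0`, take `(J₁₁ + 1, −J₀₁)`
    have hb : 0 < J 0 1 * J 0 1 := by nlinarith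
    refine ⟨J 1 1 + 1, -J 0 1, ?_⟩
    have : J 0 0 * (J 1 1 + 1) * (J 1 1 + 1) + 2 * J 0 1 * (J 1 1 + 1) * -J 0 1 + J 1 1 * -J 0 1 * -J 0 1
        = -(J 0 1 * J 0 1) * (J 1 1 + 2) := by rw [← ha0]; ring
    rw [this]
    nlinarith
  · -- `J₀₀ > 0`: take `(J₀₁, −J₀₀)`, value `J₀₀ · det J`
    refine ⟨J 0 1, -J 0 0, ?_⟩
    have : J 0 0 * J 0 1 * J 0 1 + 2 * J 0 1 * J 0 1 * -J 0 0 + J 1 1 * -J 0 0 * -J 0 0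
        = J 0 0 * (J 0 0 * J 1 1 - J 0 1 * J 0 1) := by ring
    rw [this]
    exact mul_neg_of_pos_of_neg ha0 hd

/-- **Normal form of the indefinite pivot.**  A real symmetric `2 × 2` matrix with negative determinant is congruent to
`diag(−1, 1)`: `∃ C, det C ≠ 0 ∧ Cᵀ J C = !![-1, 0; 0, 1]`.  (Frame: `v` with `vᵀJv < 0`, `w = (−(Jv)₁, (Jv)₀)`; then
`vᵀ J w = 0`, `det [v w] = vᵀ J v` and `wᵀ J w = (vᵀ J v) · det J > 0`; normalise both columns.) [folklore] -/
theorem exists_congr_eq_normalForm (J : Matrix (Fin 2) (Fin 2) ℝ) (hJ : J.IsSymm) (hdet : J.det < 0) :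
    ∃ C : Matrix (Fin 2) (Fin 2) ℝ, C.det ≠ 0 ∧ Cᵀ * J * C = !![-1, 0; 0, 1] := by
  have h10 : J 1 0 = J 0 1 := hJ.apply 0 1
  have hd : J 0 0 * J 1 1 - J 0 1 * J 0 1 < 0 := by
    rw [Matrix.det_fin_two, h10] at hdet; exact hdet
  obtain ⟨v₀, v₁, hq⟩ := exists_quadForm_neg J hJ hdet
  set a := J 0 0 with ha
  set b := J 0 1 with hb
  set c := J 1 1 with hc
  set qv := a * v₀ * v₀ + 2 * b * v₀ * v₁ + c * v₁ * v₁ with hqv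
  set w₀ := -(b * v₀ + c * v₁) with hw₀
  set w₁ := a * v₀ + b * v₁ with hw₁
  set qw := a * w₀ * w₀ + 2 * b * w₀ * w₁ + c * w₁ * w₁ with hqw
  have hqw_eq : qw = qv * (a * c - b * b) := by
    simp only [hqw, hqv, hw₀, hw₁]; ring
  have hqw_pos : 0 < qw := by rw [hqw_eq]; exact mul_pos_of_neg_of_neg hq hd
  have hcross : a * v₀ * w₀ + b * v₀ * w₁ + b * v₁ * w₀ + c * v₁ * w₁ = 0 := by
    simp only [hw₀, hw₁]; ring
  have hdet0 : v₀ * w₁ - w₀ * v₁ = qv := by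
    simp only [hqv, hw₀, hw₁]; ring
  set s := (Real.sqrt (-qv))⁻¹ with hs
  set t := (Real.sqrt qw)⁻¹ with ht
  have hsq : 0 < Real.sqrt (-qv) := Real.sqrt_pos.2 (by linarith)
  have htq : 0 < Real.sqrt qw := Real.sqrt_pos.2 hqw_pos
  have hs_ne : s ≠ 0 := inv_ne_zero hsq.ne'
  have ht_ne : t ≠ 0 := inv_ne_zero htq.ne'
  have hss : s * s * qv = -1 := by
    have h1 : s * Real.sqrt (-qv) = 1 := inv_mul_cancel₀ hsq.ne'
    have h2 : Real.sqrt (-qv) * Real.sqrt (-qv) = -qv := Real.mul_self_sqrt (by linarith)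
    nlinarith [h1, h2]
  have htt : t * t * qw = 1 := by
    have h1 : t * Real.sqrt qw = 1 := inv_mul_cancel₀ htq.ne'
    have h2 : Real.sqrt qw * Real.sqrt qw = qw := Real.mul_self_sqrt hqw_pos.le
    nlinarith [h1, h2]
  refine ⟨!![v₀ * s, w₀ * t; v₁ * s, w₁ * t], ?_, ?_⟩
  · rw [Matrix.det_fin_two]
    simp only [Matrix.of_apply, Matrix.cons_val', Matrix.cons_val_zero, Matrix.cons_val_one, Matrix.empty_val',
      Matrix.cons_val_fin_one]
    have : v₀ * s * (w₁ * t) - w₀ * t * (v₁ * s) = qv * (s * t) := by rw [← hdet0]; ring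
    rw [this]
    exact mul_ne_zero hq.ne (mul_ne_zero hs_ne ht_ne)
  · ext i j
    rw [congr_apply_two, h10]
    fin_cases i <;> fin_cases j <;>
      simp only [Matrix.of_apply, Matrix.cons_val', Matrix.cons_val_zero, Matrix.cons_val_one, Matrix.empty_val',
        Matrix.cons_val_fin_one, Fin.zero_eta, Fin.mk_one, Fin.isValue]
    · -- (0,0): `s² · qv = −1`
      have : v₀ * s * a * (v₀ * s) + v₀ * s * b * (v₁ * s) + v₁ * s * b * (v₀ * s) + v₁ * s * c * (v₁ * s)
          = s * s * qv := by simp only [hqv]; ring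
      rw [this, hss]
    · -- (0,1): cross term
      have : v₀ * s * a * (w₀ * t) + v₀ * s * b * (w₁ * t) + v₁ * s * b * (w₀ * t) + v₁ * s * c * (w₁ * t)
          = s * t * (a * v₀ * w₀ + b * v₀ * w₁ + b * v₁ * w₀ + c * v₁ * w₁) := by ring
      rw [this, hcross, mul_zero]
    · -- (1,0): cross term
      have : w₀ * t * a * (v₀ * s) + w₀ * t * b * (v₁ * s) + w₁ * t * b * (v₀ * s) + w₁ * t * c * (v₁ * s)
          = s * t * (a * v₀ * w₀ + b * v₀ * w₁ + b * v₁ * w₀ + c * v₁ * w₁) := by ring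
      rw [this, hcross, mul_zero]
    · -- (1,1): `t² · qw = 1`
      have : w₀ * t * a * (w₀ * t) + w₀ * t * b * (w₁ * t) + w₁ * t * b * (w₀ * t) + w₁ * t * c * (w₁ * t)
          = t * t * qw := by simp only [hqw]; ring
      rw [this, htt]

end normalForm

/-! ## Reduction of the `m = 2` pivot rows to the single pivot letter `diag(−1, 1)` -/

section reduction

variable {K : ℕ}

/-- **Indefinite pivot ⇒ normal form.**  A bound `Z₊ ≤ B` valid for the single pivot letter `!![-1, 0; 0, 1]` (all exponents,
all PSD letters) holds for every real symmetric `2 × 2` pivot letter with `det J < 0`. [folklore] -/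
theorem pivotPosRoots_le_of_normalForm {B : ℕ}
    (h : ∀ (e : ℕ) (d : Fin K → ℕ) (P : Fin K → Matrix (Fin 2) (Fin 2) ℝ),
      (∀ k, (P k).PosSemidef) → pivotPosRoots e d !![-1, 0; 0, 1] P ≤ B)
    (e : ℕ) (d : Fin K → ℕ) (J : Matrix (Fin 2) (Fin 2) ℝ) (P : Fin K → Matrix (Fin 2) (Fin 2) ℝ)
    (hJ : J.IsSymm) (hP : ∀ k, (P k).PosSemidef) (hdet : J.det < 0) :
    pivotPosRoots e d J P ≤ B := by
  obtain ⟨C, hC, hCJ⟩ := exists_congr_eq_normalForm J hJ hdet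
  rw [← pivotPosRoots_congr e d J P C hC, hCJ]
  exact h e d _ fun k => posSemidef_congr (hP k) C

/-- **The `2K` law at `m = 2` reduces to ONE pivot letter.**  If every pencil `X^e • diag(−1,1) + ∑ₖ X^{dₖ} • Pₖ`
(`Pₖ ⪰ 0`) has `Z₊ ≤ 2K`, then `PivotRootLawAt 2 K q (2K)` holds at every index `q` (the definite / singular pivots
being settled by `…PivotTwoDefinitePivot`). [folklore] -/
theorem pivotRootLawAt_two_of_normalForm (K q : ℕ)
    (h : ∀ (e : ℕ) (d : Fin K → ℕ) (P : Fin K → Matrix (Fin 2) (Fin 2) ℝ),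
      (∀ k, (P k).PosSemidef) → pivotPosRoots e d !![-1, 0; 0, 1] P ≤ 2 * K) :
    PivotRootLawAt 2 K q (2 * K) :=
  DefinitePivot.pivotRootLawAt_two_of_indefinite K q
    fun e d J P hJ hP hdet => pivotPosRoots_le_of_normalForm h e d J P hJ hP hdet

/-- The normal-form letter `diag(−1, 1)` is symmetric with determinant `−1`. [folklore] -/
theorem normalForm_isSymm_det :
    (!![-1, 0; 0, 1] : Matrix (Fin 2) (Fin 2) ℝ).IsSymm ∧ (!![-1, 0; 0, 1] : Matrix (Fin 2) (Fin 2) ℝ).det = -1 :=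
  ⟨Matrix.IsSymm.ext fun i j => by fin_cases i <;> fin_cases j <;> simp, by rw [Matrix.det_fin_two]; simp⟩

/-- The normal-form letter has pivot index one: `diag(−1,1) + W Wᵀ = diag(0,1) ⪰ 0` for the `2 × q` matrix `W` (`q ≥ 1`)
whose first column is `(1, 0)ᵀ` and whose other columns vanish. [folklore] -/
theorem normalForm_index {q : ℕ} (hq : 1 ≤ q) :
    ∃ W : Matrix (Fin 2) (Fin q) ℝ, ((!![-1, 0; 0, 1] : Matrix (Fin 2) (Fin 2) ℝ) + W * Wᵀ).PosSemidef := by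
  refine ⟨Matrix.of fun i j => if (j : ℕ) = 0 then (![1, 0] : Fin 2 → ℝ) i else 0, ?_⟩
  have hWW : ((Matrix.of fun i (j : Fin q) => if (j : ℕ) = 0 then (![1, 0] : Fin 2 → ℝ) i else 0)
      * (Matrix.of fun i (j : Fin q) => if (j : ℕ) = 0 then (![1, 0] : Fin 2 → ℝ) i else 0)ᵀ)
        = !![1, 0; 0, 0] := by
    ext i j
    rw [Matrix.mul_apply, Finset.sum_eq_single (⟨0, hq⟩ : Fin q)]
    · fin_cases i <;> fin_cases j <;> simp
    · intro l _ hl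
      have : (l : ℕ) ≠ 0 := fun h0 => hl (Fin.ext h0)
      simp [this]
    · intro h0; exact absurd (Finset.mem_univ _) h0
  rw [hWW]
  have hdiag : ((!![-1, 0; 0, 1] : Matrix (Fin 2) (Fin 2) ℝ) + !![1, 0; 0, 0]) = Matrix.diagonal ![0, 1] := by
    ext i j; fin_cases i <;> fin_cases j <;> simp [Matrix.diagonal]
  rw [hdiag]
  exact Matrix.PosSemidef.diagonal (fun i => by fin_cases i <;> simp)

/-- Conversely, any row `PivotRootLawAt 2 K q B` with `q ≥ 1` bounds the normal-form pencils: for `q ≥ 1` the normal form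
carries EXACTLY the content of the indefinite pivot. [folklore] -/
theorem normalForm_le_of_pivotRootLawAt {q B : ℕ} (hq : 1 ≤ q) (h : PivotRootLawAt 2 K q B)
    (e : ℕ) (d : Fin K → ℕ) (P : Fin K → Matrix (Fin 2) (Fin 2) ℝ) (hP : ∀ k, (P k).PosSemidef) :
    pivotPosRoots e d !![-1, 0; 0, 1] P ≤ B :=
  h e d _ P normalForm_isSymm_det.1 hP (normalForm_index hq)

end reduction

end Summit.ValiantsHypothesis.ValiantsHypothesis.Theorems.LacunarySymmetroidMatrixDescartes.Pivot.TwoNormalForm
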